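import Summits.RiemannHypothesis.RiemannHypothesis.Theorems.WeilColumnThetaEnvelopeE2
import Summits.RiemannHypothesis.RiemannHypothesis.Theorems.WeilColumnThetaCellNorms
import Mathlib.Analysis.Calculus.FDeriv.Measurable
import HarnessLib

/-!
# E3 at the witness: the CELLWISE `L²` bounds `A = ‖T_R⁻‖²`, `B = ‖(T⁻)′‖²` of the tier-2 theta certificate (RH-FREE)

WEIL column (LADDER-RH, W-P(P2); route `WeilSemilocal`, tier-2 twin residue, item 19172; cc-s2-1 gen22 TIER2-KERNEL-SPEC §2 «Stage 2» / §5 (K2),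
THETA-CERT-cc6 §E3). Instantiates the abstract E3-core `ThetaPrime.integral_sq_le_cellSum_add_tail` at the envelopes of E2
(`WeilColumnThetaEnvelopeE2`): with cell values `envE j ≥ tailEnv` on the closed depth cells `j < Jt` (`D = Jt·τ`) and
`envE′ j ≥ ‖T′(x₁ − t)‖/√u₁` likewise,

* `integral_norm_sq_TROdd_le_cell`: **`∫‖T_R⁻‖² ≤ 2u₁·[τ·M₀²·Σ_{j<Jt} envE_j² + M²·e^{−(2m+1)D}/(2m+1)]`** for every `R` (`|T_R| ≤ |T|`,
  disjoint supports of `T` and `T(−·)`, tail `tailEnv ≤ ζ(m+1)e^{−(m+½)t}`, `M = M₀ζ(m+1)`);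
* `integral_norm_sq_deriv_TOdd_le_cell`: **`∫‖(T⁻)′‖² ≤ 2u₁·[τ·Σ_{j<Jt} envE′_j² + (M/2)²e^{−(2m+1)D}/(2m+1) + M·M₁·e^{−2mD}/(2m) + M₁²e^{−(2m−1)D}/(2m−1)]`**
  provided `η ≤ D` (beyond depth `η` the cut's derivative vanishes, so the tail envelope is `√u₁[(M/2)e^{−(m+½)t} + M₁e^{−(m−½)t}]` by D1/D2).
These are the kernel's `Ahi`/`Bhi` shapes (K2). Nothing here bears on the truth of RH.
-/

set_option linter.dupNamespace false

noncomputable section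

open MeasureTheory Set Complex Filter Finset
open scoped Real
open Literature.NumberTheory.LFunctions
open Summit.RiemannHypothesis.RiemannHypothesis.Theorems.WeilColumn.ThetaPrime

namespace Summit.RiemannHypothesis.RiemannHypothesis.Theorems.WeilColumn.ThetaMellin

namespace ThetaParams

variable {P : ThetaParams}

/-! ## §1 The `A` side: `∫‖T_R⁻‖²` from the cells of `tailEnv` -/

/-- `tailEnv²` is integrable on `(0, ∞)` (continuous, dominated by `ζ(m+1)²e^{−(2m+1)t}`). [folklore] -/
theorem integrableOn_tailEnv_sq {qn : ℕ} (hP : P.Admissible qn) : IntegrableOn (fun t ↦ P.tailEnv t ^ 2) (Ioi 0) := by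
  have hκ : 0 < 2 * ((P.m : ℝ) + 1 / 2) := by positivity
  have hg : IntegrableOn (fun t ↦ zetaTail (P.m + 1) ^ 2 * Real.exp (-(2 * ((P.m : ℝ) + 1 / 2)) * t)) (Ioi 0) :=
    (exp_neg_integrableOn_Ioi 0 hκ).const_mul (zetaTail (P.m + 1) ^ 2)
  refine Integrable.mono' hg ((P.continuous_tailEnv hP).pow 2).aestronglyMeasurable ?_
  refine (ae_restrict_iff' measurableSet_Ioi).2 (Eventually.of_forall fun t (_ : t ∈ Ioi (0 : ℝ)) ↦ ?_)
  rw [Real.norm_of_nonneg (sq_nonneg _)]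
  have h := P.tailEnv_le_exp hP t
  have h0 := P.tailEnv_nonneg hP t
  calc P.tailEnv t ^ 2 ≤ (zetaTail (P.m + 1) * Real.exp (-((P.m : ℝ) + 1 / 2) * t)) ^ 2 := pow_le_pow_left₀ h0 h 2
    _ = zetaTail (P.m + 1) ^ 2 * Real.exp (-(2 * ((P.m : ℝ) + 1 / 2)) * t) := by
        rw [mul_pow, ← Real.exp_nat_mul]; congr 1; congr 1; push_cast; ring

/-- **E3 for `tailEnv`**: `∫_{(0,∞)} tailEnv² ≤ τ·Σ_{j<Jt} envE_j² + ζ(m+1)²e^{−(2m+1)D}/(2m+1)`. [TIER2-KERNEL-SPEC §2 (Stage 2, `Ahi`); E3-core] -/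
theorem integral_tailEnv_sq_le_cell {qn : ℕ} (hP : P.Admissible qn) {τ D : ℝ} {Jt : ℕ} (hτ : 0 < τ) (hD : D = (Jt : ℝ) * τ)
    {envE : ℕ → ℝ} (henv : ∀ j < Jt, ∀ t : ℝ, (j : ℝ) * τ ≤ t → t ≤ ((j : ℝ) + 1) * τ → P.tailEnv t ≤ envE j) :
    ∫ t in Ioi 0, P.tailEnv t ^ 2 ≤
      τ * ∑ j ∈ Finset.range Jt, envE j ^ 2 + zetaTail (P.m + 1) ^ 2 * Real.exp (-(2 * P.m + 1 : ℝ) * D) / (2 * P.m + 1) := by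
  have hζ : 0 ≤ zetaTail (P.m + 1) := le_trans (P.tailEnv_nonneg hP 0) (by simpa using P.tailEnv_le_exp hP 0)
  have h := integral_sq_le_cellSum_add_tail (κ₁ := (P.m : ℝ) + 1 / 2) (κ₂ := 1) (P := zetaTail (P.m + 1)) (Q := 0) hτ hD
    (by positivity) one_pos hζ le_rfl (P.tailEnv_nonneg hP) henv
    (fun t _ ↦ by have := P.tailEnv_le_exp hP t; simpa using this) (P.integrableOn_tailEnv_sq hP)
  refine h.trans (le_of_eq ?_)
  have e1 : -(2 * ((P.m : ℝ) + 1 / 2)) * D = -(2 * P.m + 1 : ℝ) * D := by ring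
  have e2 : (2 * ((P.m : ℝ) + 1 / 2)) = 2 * P.m + 1 := by ring
  rw [e1, e2]
  simp

/-- `‖T‖²` is integrable on `ℝ`. [folklore] -/
theorem integrable_norm_T_sq {qn : ℕ} (hP : P.Admissible qn) : Integrable (fun x ↦ ‖P.T x‖ ^ 2) := by
  -- `‖T x‖² = u₁M₀²·tailEnv(x₁ − x)²`, and `tailEnv² = 𝟙_{(0,∞)}·tailEnv²` is integrable
  have hpos : 0 < Real.sqrt P.u₁ * P.M₀ := mul_pos (Real.sqrt_pos.2 (Real.exp_pos _)) (P.M₀_pos hP)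
  have hsq : Integrable (fun t ↦ P.tailEnv t ^ 2) := by
    have h := (P.integrableOn_tailEnv_sq hP).integrable_indicator measurableSet_Ioi
    refine h.congr (Eventually.of_forall fun t ↦ ?_)
    beta_reduce
    by_cases ht : t ∈ Ioi (0 : ℝ)
    · rw [indicator_of_mem ht]
    · rw [indicator_of_notMem ht, P.tailEnv_eq_zero hP (not_lt.1 ht), zero_pow two_ne_zero]
  have h2 := (hsq.comp_sub_left P.x₁).const_mul ((Real.sqrt P.u₁ * P.M₀) ^ 2)
  refine h2.congr (Eventually.of_forall fun x ↦ ?_)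
  simp only [tailEnv, sub_sub_cancel]
  rw [div_pow, mul_div_cancel₀ _ (pow_ne_zero 2 hpos.ne')]

/-- `∫‖T‖² = u₁M₀²·∫_{(0,∞)} tailEnv²`. [folklore] -/
theorem integral_norm_T_sq_eq {qn : ℕ} (hP : P.Admissible qn) :
    ∫ x, ‖P.T x‖ ^ 2 = (Real.sqrt P.u₁ * P.M₀) ^ 2 * ∫ t in Ioi 0, P.tailEnv t ^ 2 := by
  have hpos : 0 < Real.sqrt P.u₁ * P.M₀ := mul_pos (Real.sqrt_pos.2 (Real.exp_pos _)) (P.M₀_pos hP)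
  have e1 : (fun x ↦ ‖P.T x‖ ^ 2) = fun x ↦ (Real.sqrt P.u₁ * P.M₀) ^ 2 * (fun t ↦ P.tailEnv t ^ 2) (P.x₁ - x) := by
    funext x
    simp only [tailEnv, sub_sub_cancel]
    rw [div_pow, mul_div_cancel₀ _ (pow_ne_zero 2 hpos.ne')]
  rw [e1, integral_const_mul, integral_sub_left_eq_self (fun t ↦ P.tailEnv t ^ 2) volume P.x₁]
  congr 1
  refine (setIntegral_eq_integral_of_forall_compl_eq_zero fun t ht ↦ ?_).symm
  rw [P.tailEnv_eq_zero hP (not_lt.1 ht), zero_pow two_ne_zero]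

/-- **E3 (A side) — `∫‖T_R⁻‖² ≤ 2u₁[τM₀²Σ_{j<Jt}envE_j² + M²e^{−(2m+1)D}/(2m+1)]`** for every `R`. [THETA-CERT-cc6 §E3; TIER2-KERNEL-SPEC §2/§5 (K2)] -/
theorem integral_norm_sq_TROdd_le_cell {qn : ℕ} (hP : P.Admissible qn) {τ D : ℝ} {Jt : ℕ} (hτ : 0 < τ) (hD : D = (Jt : ℝ) * τ)
    {envE : ℕ → ℝ} (henv : ∀ j < Jt, ∀ t : ℝ, (j : ℝ) * τ ≤ t → t ≤ ((j : ℝ) + 1) * τ → P.tailEnv t ≤ envE j) (R : ℝ) :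
    ∫ x, ‖P.TROdd R x‖ ^ 2 ≤
      2 * P.u₁ * (τ * P.M₀ ^ 2 * ∑ j ∈ Finset.range Jt, envE j ^ 2 + P.M ^ 2 * Real.exp (-(2 * P.m + 1 : ℝ) * D) / (2 * P.m + 1)) := by
  have hx₁ : P.x₁ < 0 := P.x₁_neg hP
  have hint := P.integrable_norm_T_sq hP
  -- disjoint supports: `‖T_R x − T_R(−x)‖² ≤ ‖T x‖² + ‖T(−x)‖²`
  have hpt : ∀ x : ℝ, ‖P.TROdd R x‖ ^ 2 ≤ ‖P.T x‖ ^ 2 + ‖P.T (-x)‖ ^ 2 := by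
    intro x
    show ‖P.TR R x - P.TR R (-x)‖ ^ 2 ≤ _
    by_cases hx : P.x₁ ≤ x
    · have h0 : P.TR R x = 0 := by
        have := P.norm_TR_le_norm_T R x
        rw [P.T_eq_zero_of_le hP hx, norm_zero] at this
        exact norm_le_zero_iff.1 this
      rw [h0, zero_sub, norm_neg]
      nlinarith [P.norm_TR_le_norm_T R (-x), norm_nonneg (P.TR R (-x)), norm_nonneg (P.T x)]
    · have hx' : P.x₁ ≤ -x := by linarith [lt_of_not_ge hx]
      have h0 : P.TR R (-x) = 0 := by
        have := P.norm_TR_le_norm_T R (-x)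
        rw [P.T_eq_zero_of_le hP hx', norm_zero] at this
        exact norm_le_zero_iff.1 this
      rw [h0, sub_zero]
      nlinarith [P.norm_TR_le_norm_T R x, norm_nonneg (P.TR R x), norm_nonneg (P.T (-x))]
  have hint2 : Integrable fun x ↦ ‖P.T x‖ ^ 2 + ‖P.T (-x)‖ ^ 2 := hint.add hint.comp_neg
  have hu : 0 < P.u₁ := Real.exp_pos _
  calc ∫ x, ‖P.TROdd R x‖ ^ 2 ≤ ∫ x, (‖P.T x‖ ^ 2 + ‖P.T (-x)‖ ^ 2) :=
        integral_mono_of_nonneg (Eventually.of_forall fun x ↦ by positivity) hint2 (Eventually.of_forall hpt)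
    _ = 2 * ∫ x, ‖P.T x‖ ^ 2 := by
        rw [integral_add hint hint.comp_neg, integral_neg_eq_self (fun x ↦ ‖P.T x‖ ^ 2) volume]; ring
    _ ≤ 2 * ((Real.sqrt P.u₁ * P.M₀) ^ 2 * (τ * ∑ j ∈ Finset.range Jt, envE j ^ 2 +
          zetaTail (P.m + 1) ^ 2 * Real.exp (-(2 * P.m + 1 : ℝ) * D) / (2 * P.m + 1))) := by
        rw [P.integral_norm_T_sq_eq hP]
        exact mul_le_mul_of_nonneg_left (mul_le_mul_of_nonneg_left (P.integral_tailEnv_sq_le_cell hP hτ hD henv) (sq_nonneg _))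
          zero_le_two
    _ = _ := by rw [mul_pow, Real.sq_sqrt hu.le, P.M_eq_M₀_mul_zetaTail]; ring

/-! ## §2 The `B` side: `∫‖(T⁻)′‖²` from the cells of `‖T′(x₁ − ·)‖/√u₁` -/

/-- The B-spline density of the cut vanishes at `η/2 − t` for `t ≤ 0` too (evenness + §1 of E2). [folklore] -/
theorem cut_deriv_depth_eq_zero_of_nonpos {qn : ℕ} (hP : P.Admissible qn) {t : ℝ} (ht : t ≤ 0) :
    (bsplineDensity (P.η / (2 * P.m)) (P.m - 1) (P.x₁ - t + P.a - P.η / 2)).re = 0 := by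
  have hm2 : 2 ≤ P.m := le_trans (by norm_num) hP.three_le
  have h := P.cut_deriv_depth_eq_zero hP.eta_pos hm2 (show P.η ≤ P.η - t by linarith)
  rw [P.cut_deriv_arg] at h ⊢
  rw [show P.η / 2 - t = -(P.η / 2 - (P.η - t)) by ring, bsplineDensity_neg]
  exact h

/-- **`T′(x₁ − t) = 0` for `t ≤ 0`** (both `1 − χ` and `χ′` vanish at and above the cut point). [folklore] -/
theorem deriv_T_depth_eq_zero {qn : ℕ} (hP : P.Admissible qn) {t : ℝ} (ht : t ≤ 0) : deriv P.T (P.x₁ - t) = 0 := by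
  have hm : 1 ≤ P.m := le_trans (by norm_num) hP.three_le
  rw [(P.hasDerivAt_T hP (P.x₁ - t)).deriv, P.cut_eq_one hP.eta_pos hm (by linarith), P.cut_deriv_depth_eq_zero_of_nonpos hP ht]
  simp

/-- **The tail envelope of `T′` beyond depth `η`**: for `t ≥ max 0 η`, `‖T′(x₁ − t)‖ ≤ √u₁·[(M/2)e^{−(m+½)t} + M₁e^{−(m−½)t}]`
(`χ′ = 0` there; D1 and D2). [THETA-CERT-cc6 §E3] -/
theorem norm_deriv_T_depth_le_tail {qn : ℕ} (hP : P.Admissible qn) {t : ℝ} (ht0 : 0 ≤ t) (htη : P.η ≤ t) :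
    ‖deriv P.T (P.x₁ - t)‖ ≤ Real.sqrt P.u₁ * (P.M / 2 * Real.exp (-((P.m : ℝ) + 1 / 2) * t) +
      P.M₁ * Real.exp (-((P.m : ℝ) - 1 / 2) * t)) := by
  have hm : 1 ≤ P.m := le_trans (by norm_num) hP.three_le
  have hm2 : 2 ≤ P.m := le_trans (by norm_num) hP.three_le
  have hu : 0 < P.u₁ := Real.exp_pos _
  rw [(P.hasDerivAt_T hP (P.x₁ - t)).deriv, P.cut_deriv_depth_eq_zero hP.eta_pos hm2 htη]
  simp only [Complex.ofReal_zero, mul_zero, sub_zero]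
  have hc := P.one_sub_cut_depth_mem_Icc hP.eta_pos hm t
  -- D1 and D2 at `u = e^{x₁ − t} ≤ u₁`
  have hux : Real.exp (P.x₁ - t) ∈ Ioc (0 : ℝ) P.u₁ := ⟨Real.exp_pos _, by unfold u₁; exact Real.exp_le_exp.2 (by linarith)⟩
  have hD1 := P.norm_Θ_le' hP hux.1
  have hD2 := P.D2_on_Ioc hP _ hux
  have hratio : Real.exp (P.x₁ - t) / P.u₁ = Real.exp (-t) := by rw [P.exp_depth, mul_div_cancel_left₀ _ hu.ne']
  rw [hratio] at hD1 hD2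
  have hA : ‖(Real.exp ((P.x₁ - t) / 2) : ℂ)‖ = Real.sqrt P.u₁ * Real.exp (-(1 / 2 : ℝ) * t) := by
    rw [Complex.norm_real, Real.norm_of_nonneg (Real.exp_pos _).le, P.exp_half_depth]
  have hC : ‖(((1 - P.cut (P.x₁ - t) : ℝ)) : ℂ)‖ ≤ 1 := by rw [Complex.norm_real, Real.norm_of_nonneg hc.1]; exact hc.2
  have hB : ‖(1 / 2 : ℂ) * P.Θ (Real.exp (P.x₁ - t)) + (Real.exp (P.x₁ - t) : ℂ) * deriv P.Θ (Real.exp (P.x₁ - t))‖ ≤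
      P.M / 2 * Real.exp (-t) ^ P.m + P.M₁ * Real.exp (-t) ^ (P.m - 1) := by
    refine (norm_add_le _ _).trans (add_le_add ?_ hD2)
    rw [norm_mul, show ‖(1 / 2 : ℂ)‖ = 1 / 2 by norm_num]
    linarith
  have hB0 : 0 ≤ P.M / 2 * Real.exp (-t) ^ P.m + P.M₁ * Real.exp (-t) ^ (P.m - 1) := le_trans (norm_nonneg _) hB
  have hpre : 0 ≤ Real.sqrt P.u₁ * Real.exp (-(1 / 2 : ℝ) * t) := by positivity
  calc ‖(Real.exp ((P.x₁ - t) / 2) : ℂ) * ((1 / 2 : ℂ) * P.Θ (Real.exp (P.x₁ - t)) +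
          (Real.exp (P.x₁ - t) : ℂ) * deriv P.Θ (Real.exp (P.x₁ - t))) * (((1 - P.cut (P.x₁ - t) : ℝ)) : ℂ)‖
      ≤ Real.sqrt P.u₁ * Real.exp (-(1 / 2 : ℝ) * t) * (P.M / 2 * Real.exp (-t) ^ P.m + P.M₁ * Real.exp (-t) ^ (P.m - 1)) * 1 := by
        rw [norm_mul, norm_mul, hA]
        exact mul_le_mul (mul_le_mul_of_nonneg_left hB hpre) hC (norm_nonneg _) (mul_nonneg hpre hB0)
    _ = _ := by
        have e1 : Real.exp (-(1 / 2 : ℝ) * t) * Real.exp (-t) ^ P.m = Real.exp (-((P.m : ℝ) + 1 / 2) * t) := by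
          rw [← Real.exp_nat_mul, ← Real.exp_add]; congr 1; ring
        have e2 : Real.exp (-(1 / 2 : ℝ) * t) * Real.exp (-t) ^ (P.m - 1) = Real.exp (-((P.m : ℝ) - 1 / 2) * t) := by
          rw [← Real.exp_nat_mul, ← Real.exp_add, Nat.cast_sub hm]; congr 1; push_cast; ring
        rw [mul_one, mul_assoc (Real.sqrt P.u₁), mul_add (Real.exp (-(1 / 2 : ℝ) * t)), ← mul_assoc, ← mul_assoc,
          mul_comm (Real.exp (-(1 / 2 : ℝ) * t)) (P.M / 2), mul_comm (Real.exp (-(1 / 2 : ℝ) * t)) P.M₁, mul_assoc (P.M / 2),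
          mul_assoc P.M₁, e1, e2]

/-- **The global envelope of `T′` below the cut**: for `t ≥ 0`, `‖T′(x₁ − t)‖ ≤ √u₁·[(½ + m/η)M e^{−(m+½)t} + M₁e^{−(m−½)t}]` (tier 1). [THETA-CERT-cc6 §D3] -/
theorem norm_deriv_T_depth_le_global {qn : ℕ} (hP : P.Admissible qn) {t : ℝ} (ht0 : 0 ≤ t) :
    ‖deriv P.T (P.x₁ - t)‖ ≤ Real.sqrt P.u₁ * ((1 / 2 + P.m / P.η) * P.M * Real.exp (-((P.m : ℝ) + 1 / 2) * t) +
      P.M₁ * Real.exp (-((P.m : ℝ) - 1 / 2) * t)) := by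
  have hm : 1 ≤ P.m := le_trans (by norm_num) hP.three_le
  have hm2 : 2 ≤ P.m := le_trans (by norm_num) hP.three_le
  rw [(P.hasDerivAt_T hP (P.x₁ - t)).deriv]
  have h := ThetaTail.norm_deriv_tail_le (Θ := P.Θ) (Θ' := deriv P.Θ) (χ := P.cut)
    (χ' := fun x ↦ (bsplineDensity (P.η / (2 * P.m)) (P.m - 1) (x + P.a - P.η / 2)).re) (M := P.M) (M₁ := P.M₁)
    (L := P.m / P.η) (m := P.m) (rfl : P.u₁ = Real.exp P.x₁) (fun v hv ↦ P.norm_Θ_le' hP hv.1) (P.D2_on_Ioc hP)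
    (P.cut_mem_Icc hP.eta_pos hm) (fun x ↦ P.abs_cut_deriv_le hP.eta_pos hm2 x) (show P.x₁ - t ≤ P.x₁ by linarith)
  refine h.trans (le_of_eq ?_)
  have e1 := ThetaTail.envelope_eq (M := (1 / 2 + P.m / P.η) * P.M) (m := P.m) (rfl : P.u₁ = Real.exp P.x₁) (P.x₁ - t)
  have e2 := ThetaTail.envelope_eq (M := P.M₁) (m := P.m - 1) (rfl : P.u₁ = Real.exp P.x₁) (P.x₁ - t)
  rw [e1, e2, Nat.cast_sub hm]
  push_cast
  have e3 : ((P.m : ℝ) + 1 / 2) * (P.x₁ - t - P.x₁) = -((P.m : ℝ) + 1 / 2) * t := by ring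
  have e4 : ((P.m : ℝ) - 1 + 1 / 2) * (P.x₁ - t - P.x₁) = -((P.m : ℝ) - 1 / 2) * t := by ring
  rw [e3, e4]; ring

/-- `0 ≤ M` and `0 ≤ M₁`. [folklore] -/
theorem M_nonneg_M₁_nonneg {qn : ℕ} (hP : P.Admissible qn) : 0 ≤ P.M ∧ 0 ≤ P.M₁ := by
  have hu : 0 < P.u₁ := Real.exp_pos _
  refine ⟨?_, ?_⟩
  · have h := le_trans (norm_nonneg _) (P.norm_Θ_le' hP Real.zero_lt_one)
    have hc : 0 < (1 / P.u₁) ^ P.m := by positivity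
    exact le_of_mul_le_mul_right (by rwa [zero_mul]) hc
  · have h := le_trans (norm_nonneg _) (P.D2_on_Ioc hP P.u₁ ⟨hu, le_rfl⟩)
    rwa [div_self hu.ne', one_pow, mul_one] at h

/-- `‖T′(x₁ − ·)‖²/u₁` is integrable on `(0, ∞)` (measurable; dominated by the square of the global envelope). [folklore] -/
theorem integrableOn_deriv_T_depth_sq {qn : ℕ} (hP : P.Admissible qn) :
    IntegrableOn (fun t ↦ (‖deriv P.T (P.x₁ - t)‖ / Real.sqrt P.u₁) ^ 2) (Ioi 0) := by
  obtain ⟨hM, hM₁⟩ := M_nonneg_M₁_nonneg hP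
  have hsu : 0 < Real.sqrt P.u₁ := Real.sqrt_pos.2 (Real.exp_pos _)
  set a : ℝ := (1 / 2 + P.m / P.η) * P.M with ha
  set b : ℝ := P.M₁ with hb
  have ha0 : 0 ≤ a := by rw [ha]; have := hP.eta_pos; positivity
  have hκ₁ : 0 < 2 * ((P.m : ℝ) + 1 / 2) := by positivity
  have hκ₂ : 0 < 2 * ((P.m : ℝ) - 1 / 2) := by
    have : (1 : ℝ) ≤ P.m := by exact_mod_cast (le_trans (by norm_num) hP.three_le : 1 ≤ P.m)
    linarith
  -- the dominating function `2a²e^{−(2m+1)t} + 2b²e^{−(2m−1)t}`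
  have hg : IntegrableOn (fun t ↦ 2 * a ^ 2 * Real.exp (-(2 * ((P.m : ℝ) + 1 / 2)) * t) +
      2 * b ^ 2 * Real.exp (-(2 * ((P.m : ℝ) - 1 / 2)) * t)) (Ioi 0) :=
    ((exp_neg_integrableOn_Ioi 0 hκ₁).const_mul _).add ((exp_neg_integrableOn_Ioi 0 hκ₂).const_mul _)
  have hmeas : AEStronglyMeasurable (fun t ↦ (‖deriv P.T (P.x₁ - t)‖ / Real.sqrt P.u₁) ^ 2) (volume.restrict (Ioi 0)) :=
    ((((measurable_deriv P.T).comp (measurable_const.sub measurable_id)).norm.div_const _).pow_const 2).aestronglyMeasurable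
  refine Integrable.mono' hg hmeas ((ae_restrict_iff' measurableSet_Ioi).2 (Eventually.of_forall fun t (ht : t ∈ Ioi (0 : ℝ)) ↦ ?_))
  rw [Real.norm_of_nonneg (sq_nonneg _)]
  have h := P.norm_deriv_T_depth_le_global hP (le_of_lt ht)
  have hq : ‖deriv P.T (P.x₁ - t)‖ / Real.sqrt P.u₁ ≤ a * Real.exp (-((P.m : ℝ) + 1 / 2) * t) + b * Real.exp (-((P.m : ℝ) - 1 / 2) * t) := by
    rw [div_le_iff₀ hsu, ha, hb]; linarith
  have hq0 : 0 ≤ ‖deriv P.T (P.x₁ - t)‖ / Real.sqrt P.u₁ := div_nonneg (norm_nonneg _) hsu.le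
  have hX := sq_nonneg (a * Real.exp (-((P.m : ℝ) + 1 / 2) * t) - b * Real.exp (-((P.m : ℝ) - 1 / 2) * t))
  have hsqA : (a * Real.exp (-((P.m : ℝ) + 1 / 2) * t)) ^ 2 = a ^ 2 * Real.exp (-(2 * ((P.m : ℝ) + 1 / 2)) * t) := by
    rw [mul_pow, ← Real.exp_nat_mul]; congr 1; congr 1; push_cast; ring
  have hsqB : (b * Real.exp (-((P.m : ℝ) - 1 / 2) * t)) ^ 2 = b ^ 2 * Real.exp (-(2 * ((P.m : ℝ) - 1 / 2)) * t) := by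
    rw [mul_pow, ← Real.exp_nat_mul]; congr 1; congr 1; push_cast; ring
  nlinarith [pow_le_pow_left₀ hq0 hq 2]

/-- **E3 (B side, cells)**: `∫_{(0,∞)} (‖T′(x₁ − t)‖/√u₁)² ≤ τΣ_{j<Jt}envE′_j² + (M/2)²e^{−(2m+1)D}/(2m+1) + MM₁e^{−2mD}/(2m) + M₁²e^{−(2m−1)D}/(2m−1)`
(`η ≤ D`). [THETA-CERT-cc6 §E3; TIER2-KERNEL-SPEC §2 (`Bhi`)] -/
theorem integral_deriv_T_depth_sq_le_cell {qn : ℕ} (hP : P.Admissible qn) {τ D : ℝ} {Jt : ℕ} (hτ : 0 < τ)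
    (hD : D = (Jt : ℝ) * τ) (hηD : P.η ≤ D) {envE' : ℕ → ℝ}
    (henv' : ∀ j < Jt, ∀ t : ℝ, (j : ℝ) * τ ≤ t → t ≤ ((j : ℝ) + 1) * τ → ‖deriv P.T (P.x₁ - t)‖ / Real.sqrt P.u₁ ≤ envE' j) :
    ∫ t in Ioi 0, (‖deriv P.T (P.x₁ - t)‖ / Real.sqrt P.u₁) ^ 2 ≤
      τ * ∑ j ∈ Finset.range Jt, envE' j ^ 2 +
        ((P.M / 2) ^ 2 * Real.exp (-(2 * P.m + 1 : ℝ) * D) / (2 * P.m + 1) + P.M * P.M₁ * Real.exp (-(2 * P.m : ℝ) * D) / (2 * P.m) +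
          P.M₁ ^ 2 * Real.exp (-(2 * P.m - 1 : ℝ) * D) / (2 * P.m - 1)) := by
  obtain ⟨hM, hM₁⟩ := M_nonneg_M₁_nonneg hP
  have hsu : 0 < Real.sqrt P.u₁ := Real.sqrt_pos.2 (Real.exp_pos _)
  have hm1 : (1 : ℝ) ≤ P.m := by exact_mod_cast (le_trans (by norm_num) hP.three_le : 1 ≤ P.m)
  have hD0 : 0 ≤ D := by rw [hD]; positivity
  have h := integral_sq_le_cellSum_add_tail (κ₁ := (P.m : ℝ) + 1 / 2) (κ₂ := (P.m : ℝ) - 1 / 2) (P := P.M / 2) (Q := P.M₁)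
    (e := fun t ↦ ‖deriv P.T (P.x₁ - t)‖ / Real.sqrt P.u₁) hτ hD (by positivity) (by linarith) (by positivity) hM₁
    (fun t ↦ div_nonneg (norm_nonneg _) hsu.le) henv'
    (fun t ht ↦ by
      rw [div_le_iff₀ hsu]
      have := P.norm_deriv_T_depth_le_tail hP (hD0.trans ht.le) (hηD.trans ht.le)
      linarith)
    (P.integrableOn_deriv_T_depth_sq hP)
  refine h.trans (le_of_eq ?_)
  congr 1
  have e1 : -(2 * ((P.m : ℝ) + 1 / 2)) * D = -(2 * P.m + 1 : ℝ) * D := by ring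
  have e2 : (2 * ((P.m : ℝ) + 1 / 2)) = 2 * P.m + 1 := by ring
  have e3 : -((P.m : ℝ) + 1 / 2 + ((P.m : ℝ) - 1 / 2)) * D = -(2 * P.m : ℝ) * D := by ring
  have e4 : ((P.m : ℝ) + 1 / 2 + ((P.m : ℝ) - 1 / 2)) = 2 * P.m := by ring
  have e5 : -(2 * ((P.m : ℝ) - 1 / 2)) * D = -(2 * P.m - 1 : ℝ) * D := by ring
  have e6 : (2 * ((P.m : ℝ) - 1 / 2)) = 2 * P.m - 1 := by ring
  rw [e1, e2, e3, e4, e5, e6]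
  ring

/-- `(T⁻)′(x) = T′(x) + T′(−x)`. [folklore] -/
theorem hasDerivAt_TOdd_deriv {qn : ℕ} (hP : P.Admissible qn) (x : ℝ) : HasDerivAt P.TOdd (deriv P.T x + deriv P.T (-x)) x := by
  have h1 := P.hasDerivAt_T hP x
  have h1' := P.hasDerivAt_T hP (-x)
  have h2 := h1'.scomp x (hasDerivAt_neg x)
  have h : HasDerivAt P.TOdd _ x := h1.sub h2
  rw [h1.deriv, h1'.deriv]
  refine h.congr_deriv ?_
  rw [neg_one_smul]
  ring

/-- **E3 (B side) — `∫‖(T⁻)′‖² ≤ 2u₁[τΣ_{j<Jt}envE′_j² + (M/2)²e^{−(2m+1)D}/(2m+1) + MM₁e^{−2mD}/(2m) + M₁²e^{−(2m−1)D}/(2m−1)]`** (`η ≤ D`).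
[THETA-CERT-cc6 §E3; TIER2-KERNEL-SPEC §2/§5 (K2)] -/
theorem integral_norm_sq_deriv_TOdd_le_cell {qn : ℕ} (hP : P.Admissible qn) {τ D : ℝ} {Jt : ℕ} (hτ : 0 < τ)
    (hD : D = (Jt : ℝ) * τ) (hηD : P.η ≤ D) {envE' : ℕ → ℝ}
    (henv' : ∀ j < Jt, ∀ t : ℝ, (j : ℝ) * τ ≤ t → t ≤ ((j : ℝ) + 1) * τ → ‖deriv P.T (P.x₁ - t)‖ / Real.sqrt P.u₁ ≤ envE' j) :
    ∫ x, ‖deriv P.TOdd x‖ ^ 2 ≤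
      2 * P.u₁ * (τ * ∑ j ∈ Finset.range Jt, envE' j ^ 2 +
        ((P.M / 2) ^ 2 * Real.exp (-(2 * P.m + 1 : ℝ) * D) / (2 * P.m + 1) + P.M * P.M₁ * Real.exp (-(2 * P.m : ℝ) * D) / (2 * P.m) +
          P.M₁ ^ 2 * Real.exp (-(2 * P.m - 1 : ℝ) * D) / (2 * P.m - 1))) := by
  have hx₁ : P.x₁ < 0 := P.x₁_neg hP
  have hu : 0 < P.u₁ := Real.exp_pos _
  have hsu : 0 < Real.sqrt P.u₁ := Real.sqrt_pos.2 hu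
  set G : ℝ → ℝ := fun x ↦ ‖deriv P.T x‖ ^ 2 with hG
  -- integrability of `G` on `ℝ`: `G(x) = u₁·e′(x₁ − x)²` with `e′² = 𝟙_{(0,∞)}e′²` integrable
  have hsq : Integrable (fun t ↦ (‖deriv P.T (P.x₁ - t)‖ / Real.sqrt P.u₁) ^ 2) := by
    have h := (P.integrableOn_deriv_T_depth_sq hP).integrable_indicator measurableSet_Ioi
    refine h.congr (Eventually.of_forall fun t ↦ ?_)
    beta_reduce
    by_cases ht : t ∈ Ioi (0 : ℝ)
    · rw [indicator_of_mem ht]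
    · rw [indicator_of_notMem ht, P.deriv_T_depth_eq_zero hP (not_lt.1 ht), norm_zero, zero_div, zero_pow two_ne_zero]
  have hGeq : G = fun x ↦ P.u₁ * (fun t ↦ (‖deriv P.T (P.x₁ - t)‖ / Real.sqrt P.u₁) ^ 2) (P.x₁ - x) := by
    funext x
    simp only [hG, sub_sub_cancel, div_pow, Real.sq_sqrt hu.le]
    rw [mul_div_cancel₀ _ hu.ne']
  have hint : Integrable G := by rw [hGeq]; exact (hsq.comp_sub_left P.x₁).const_mul P.u₁
  have hGint : ∫ x, G x = P.u₁ * ∫ t in Ioi 0, (‖deriv P.T (P.x₁ - t)‖ / Real.sqrt P.u₁) ^ 2 := by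
    rw [hGeq, integral_const_mul, integral_sub_left_eq_self (fun t ↦ (‖deriv P.T (P.x₁ - t)‖ / Real.sqrt P.u₁) ^ 2) volume P.x₁]
    congr 1
    refine (setIntegral_eq_integral_of_forall_compl_eq_zero fun t ht ↦ ?_).symm
    rw [P.deriv_T_depth_eq_zero hP (not_lt.1 ht), norm_zero, zero_div, zero_pow two_ne_zero]
  -- disjointness of the supports of `T′` and `T′(−·)`
  have hzero : ∀ y, P.x₁ ≤ y → deriv P.T y = 0 := fun y hy ↦ by
    have := P.deriv_T_depth_eq_zero hP (show P.x₁ - y ≤ 0 by linarith)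
    rwa [sub_sub_cancel] at this
  have hpt : ∀ x : ℝ, ‖deriv P.TOdd x‖ ^ 2 ≤ G x + G (-x) := by
    intro x
    rw [(P.hasDerivAt_TOdd_deriv hP x).deriv]
    by_cases hx : P.x₁ ≤ x
    · rw [hzero x hx, zero_add]
      simp only [hG]
      nlinarith [norm_nonneg (deriv P.T x)]
    · have hx' : P.x₁ ≤ -x := by linarith [lt_of_not_ge hx]
      rw [hzero (-x) hx', add_zero]
      simp only [hG]
      nlinarith [norm_nonneg (deriv P.T (-x))]
  have hint2 : Integrable fun x ↦ G x + G (-x) := hint.add hint.comp_neg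
  calc ∫ x, ‖deriv P.TOdd x‖ ^ 2 ≤ ∫ x, (G x + G (-x)) :=
        integral_mono_of_nonneg (Eventually.of_forall fun x ↦ by positivity) hint2 (Eventually.of_forall hpt)
    _ = 2 * ∫ x, G x := by rw [integral_add hint hint.comp_neg, integral_neg_eq_self G volume]; ring
    _ ≤ _ := by
        rw [hGint]
        have := P.integral_deriv_T_depth_sq_le_cell hP hτ hD hηD henv'
        nlinarith [this, hu.le]

end ThetaParams

end Summit.RiemannHypothesis.RiemannHypothesis.Theorems.WeilColumn.ThetaMellin
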